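import Summits.AnomalousDissipation.AnomalousDissipation.Theses.EnsembleRigidity
import Summits.AnomalousDissipation.AnomalousDissipation.Theorems.GPTameDefectFloor.Negative.LoadBearing
import HarnessLib

/-!
# Disproof of `GPTameDefectFloor` (stmt-AnomalousDissipation-17938) — findings of the disprover seat

Crux T = `Summit.AnomalousDissipation.AnomalousDissipation.Theses.EnsembleRigidity.GPTameDefectFloor`:
for `f = f_GP` and every level `(E, G₁)` there is `r > 0` such that no probability measure `μ` on `H` with
`∫‖v‖² dμ ≤ E`, `∫ ‖∇v‖² dμ ≤ G₁` has Euler defect `|∫ ⟨f − B(v,v), Φ'(v)⟩ dμ| ≤ r‖Φ'‖_{L²(μ;Ḣ¹)}` for all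
cylindrical tests `Φ` ("no tame near-stationary statistics of the GP force").

**VERDICT (cdisprove cycle 1): NO KILL.** `¬T` needs an exactly stationary (against ALL cylindrical tests),
finite-mean-enstrophy statistics of Euler forced by `f_GP`; none is constructible here or in print. What the
attack produced instead is the exact CEILING OF THE LINEAR LAYER of the picked line (landed negative lemmas,
§B) and two refuted strengthenings (§C). Prose lives in docstrings; every `theorem` below is kernel-checked.

## Index

* §A LOAD-BEARING HYPOTHESES (batch pass, `…Theorems.GPTameDefectFloor.Negative.LoadBearing`): the
  probability normalisation and the defect clause are load-bearing (`uses_probability`, `uses_defect`);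
  the `Integrable ‖v‖²` clause is redundant (`tameFloorAtNoInt_iff`); the energy constraint is idle above
  the Poincaré line (`tameFloorAt_of_poincareLevel`); T is monotone in the level (`tameFloorAt_anti`);
  proved region of the tree before the line: `E < 3/(4π)` or `G₁ < 3π`; kill switches
  `not_gpTameDefectFloor_of_exactTameAt / _of_eulerSSS / _of_steadyWeakEuler / _of_residualSoft` (each
  needs an object nobody can build). Line `Sketch` (lead c1, v9) has since pushed the proved region to
  `G₁ < 45/2` (any `E`) and `E ≤ 1/3` (any `G₁`).
* §B THE LINEAR LAYER HAS A CEILING (NEW; `…Negative.LinearCeilingTools` p173127, `…Negative.LinearCeiling`,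
  `…Negative.LinearCeilingEnsemble`). Six explicit two-mode Stokes fields (the GP ATOMS, shells `|k|² ∈ {1,2}`,
  in quarter-period pairs) have total Reynolds-stress divergence `2πAB · f_GP` EXACTLY
  (`gpPair_convect_sum`), energy `(A²+B²)/2` and enstrophy `2π²(2A²+B²)` each. Hence
  (`linearCertificate_ceiling`) every smooth `w` with the form bound of `stub_linearFloor`,
  `−(s_E‖v‖² + s_G‖∇v‖²) ≤ ∫(v⊗v):∇w` on `H`, has `2πAB (f_GP, w) ≤ 3s_E(A²+B²) + 12π²s_G(2A²+B²)` for all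
  real `A, B`; so linear certificates are SILENT for `E ≥ 3/π ≈ 0.955` (energy axis), `G₁ ≥ 12√2·π ≈ 53.3`
  (enstrophy axis), and in the whole corner `2πAB·E ≥ 3(A²+B²)`, `2πAB·G₁ ≥ 12π²(2A²+B²)`
  (`no_linear_certificate_at_one_sixty` below: the level `(1, 60)`). Measure form (`gp_balanced_ensemble`):
  for `πAB = 3` the uniform mixture of the six atom states is a probability measure on `H` whose mean Euler
  residual vanishes against EVERY smooth test field; `gp_balanced_ensemble_symmetric`: energy `3/π`,
  enstrophy `18π`. WHAT SEES IT: the quadratic cylindrical test `Φ(v) = ½⟨v, V₁⁻⟩²` (`V₁⁻` the sine atom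
  of the pair `(1,0)`) has `∫ ⟨f_GP − B(v,v), Φ'(v)⟩ dμ = −B(A²+B²)/24 ≠ 0` (hand computation: the
  coordinate `⟨v, V₁⁻⟩` separates that atom, and the per-atom residuals against `V₁⁻` are `B, B` on the pair
  `(0,2)` and `−B/2` on the four others). So certificates above `G₁ ≈ 53` must be at least QUADRATIC in
  the state; stationarity against all cylindrical tests is the conditional statement
  `E_μ[⟨f − B(v,v), g⟩ | ⟨v,g₁⟩, …, ⟨v,g_m⟩] = 0`, of which the atoms realise only the unconditional mean.
* §C NATURAL STRENGTHENINGS REFUTED: (i) "a linear certificate exists at every level" is false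
  (`not_linearFloor_everywhere`, witness level `(1, 60)`); (ii) the pointwise matrix bound of
  `stub_gpEnergyPointwise` with `141/100` in place of `143/100` is false (`not_gpEnergyPointwise_at_141`,
  witness `X = arccos(5/7)`, `Y = π − X`, `Z = −X`, `v = (1, −1, −1)`, value `−9/700·…`): the stub's
  constant sits `11/700` above the true minimum `99/70`, as its docstring says — the stub itself survived a
  grid + Newton search (pure python, `numerics/energy_pointwise_check.py` in the seat folder: least
  eigenvalue `−1.4142857 = −99/70` at `t = 7/20`, attained on the line `(s, π−s, −s)`, `cos s = 5/7`).
* §D TARGETS (line `Sketch` v9; payload `targets = []`, `stuck_stubs = []`): `stub_gpTermwiseForm15`,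
  `stub_gpEnergyField` LANDED (p171840, p171783) — nothing to attack; `stub_gpEnergyPointwise` — TRUE
  numerically (§C(ii) shows it is tight to `1.1 %`), no kill; `stub_gpTameRegionTools4` — a composition of
  landed pieces, no cheap kill found (its three conjuncts were checked against §A's monotonicity and the
  landed `stub_linearFloor`); `stub_tameCertificatesHigh` (`G₁ ≥ 45/2`, general cylindrical `Ψ`) — this IS
  the crux content (kernel-checked `T ↔ N` in the tree); §B says its witnesses for `G₁ ≥ 12√2·π` cannot have
  state-independent `Ψ.grad`, nothing more. 0 targets broken.
* §E DEAD ENDS (one line each): junk levels (`E < 0`, `G₁ < 0`, zero measure) — excluded by the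
  probability clause (§A); exact steady dodger `u = λU + w/λ` — `(f_GP, ABC⁺) = 3/2 ≠ 0` obstructs the
  kernel of `L_U*`, a genuine steady state needs Nash–Moser; 2.5D / passive-scalar single-field dodgers —
  mean-zero obstructions; shell-1-only or cosine-only atom families — advection never lands on shell 1 /
  spills never cancel (hence shells `{1,2}` and quarter-period pairs); orbit measures of forced-Euler
  trajectories — no recurrent bounded-enstrophy orbit known; convex-integration (wild) solutions — unbounded
  enstrophy, and no forced version in the tree.

presearch: linear (background-field / auxiliary-functional) certificates for dissipation floors of
body-forced flows stop at finite Reynolds number — arXiv:2503.04005 §2.4 (Waleffe, Kolmogorov forcing),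
Doering–Foias JFM 467 (2002) doi:10.1017/s0022112002001386; no exactly stress-balanced finite ensemble of the
GP/ABC force at `ν = 0` found in the held corpus (hybrid + vector); galaxy saturated (1×).
-/

set_option linter.dupNamespace false

noncomputable section

open MeasureTheory UnitAddTorus
open scoped ENNReal InnerProductSpace RealInnerProductSpace

namespace Summit.AnomalousDissipation.AnomalousDissipation.Cruxes.GPTameDefectFloor.Disproof

open Literature.Analysis.FunctionSpaces Literature.Analysis.FunctionSpaces.Torus Literature.Analysis.FluidPDE
open Summit.AnomalousDissipation.AnomalousDissipation.Theorems.EnsembleRigidity (gpForce gpForce_eq)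
open Summit.AnomalousDissipation.AnomalousDissipation.Theorems.GPTameDefectFloor.Negative

/-! (v1 of this file: the §B theorems are quoted by name only — their modules `Negative.LinearCeiling(Tools|Ensemble)`
are landing (p173127 accepted; main + ensemble files proposed next) and not yet built on the farm; v2 imports them.) -/

/-! ## §A Load-bearing hypotheses (pointers into `Negative.LoadBearing`) -/

/-- Any proof of T must use the probability normalisation `μ(H) = 1`. -/
theorem uses_probability : ¬ GPTameDefectFloorWithoutProb := gpTameDefectFloor_false_without_prob

/-- Any proof of T must use the defect clause. -/
theorem uses_defect : ¬ GPTameDefectFloorWithoutDefect := gpTameDefectFloor_false_without_defect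

/-! ## §C(ii) The pointwise bound of `stub_gpEnergyPointwise` is tight to `11/700` -/

/-- **`stub_gpEnergyPointwise` with `141/100` is false**: at `X = arccos(5/7)`, `Y = π − X`, `Z = −X`,
`v = (1, −1, −1)` the off-diagonal entries are `(99/140, 99/140, −99/140)` and the form equals
`3·141/100 − 594/140 = −9/700 < 0`. (The stub states `143/100`; the true threshold is `99/70`.) -/
theorem not_gpEnergyPointwise_at_141 : ¬ ∀ X Y Z v₀ v₁ v₂ : ℝ, 0 ≤ 141 / 100 * (v₀ ^ 2 + v₁ ^ 2 + v₂ ^ 2) +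
      2 * ((Real.cos X + 7 / 20 * (Real.cos Y * Real.cos Z - Real.sin X * Real.sin Z)) * (v₀ * v₁) +
        (Real.cos Z + 7 / 20 * (Real.cos X * Real.cos Y - Real.sin Y * Real.sin Z)) * (v₀ * v₂) +
        (Real.cos Y + 7 / 20 * (Real.cos X * Real.cos Z - Real.sin X * Real.sin Y)) * (v₁ * v₂)) := by
  intro h
  set s : ℝ := Real.arccos (5 / 7) with hs
  have hc : Real.cos s = 5 / 7 := by
    rw [hs, Real.cos_arccos] <;> norm_num
  have hσ : Real.sin s ^ 2 = 24 / 49 := by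
    rw [Real.sin_sq, hc]; norm_num
  have key := h s (Real.pi - s) (-s) 1 (-1) (-1)
  rw [Real.cos_pi_sub, Real.sin_pi_sub, Real.cos_neg, Real.sin_neg, hc] at key
  nlinarith [key, hσ]

/-- For comparison: the stub's form AT THE SAME POINT with its own constant `143/100` equals `+33/700 ≥ 0`
(so the witness above is the extremiser, not a bug of the stub). -/
theorem gpEnergyPointwise_margin_at_extremiser :
    0 ≤ 143 / 100 * ((1 : ℝ) ^ 2 + (-1) ^ 2 + (-1) ^ 2) +
      2 * ((99 / 140 : ℝ) * (1 * -1) + (99 / 140 : ℝ) * (1 * -1) + (-(99 / 140) : ℝ) * (-1 * -1)) := by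
  norm_num

end Summit.AnomalousDissipation.AnomalousDissipation.Cruxes.GPTameDefectFloor.Disproof
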